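import Summits.AtomisticToContinuum.Crystallization.Theorems.OverbindingBudgetUniformCutDensity

/-!
# OverbindingBudget — «EdgeRelaxation»: the uniform Liouville law LIOUBᵘ cut ENERGETICALLY (decomp-a2c lens-4, generation 26; statements)

Helper file (`--supports stmt-AtomisticToContinuum-31280`).  Route `OverbindingBudget` (Crystallization), crux `RobustDefectLimitWindows`
(stmt-AtomisticToContinuum-31280), registered line v8 «UniformCut» (registry frozen g26–g28).  Cone of record (generation 25,
`…UniformCutDensity.rdef_of_grossU_liouBallsU_coherent`): `GrossCleanBallsU T₀ 10 → CleanLiouvilleBallsU T₀ 10 → CleanlessExcessT →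
CoherentResidual 10 → RobustDefectLimitWindows` (`T₀ > 0`; record `T₀ = 1/250`).  The cell critic (CRITIC-LEDGER rows 348/361) asked for an
ENERGETIC attack on the second law LIOUBᵘ = `CleanLiouvilleBallsU` — a law whose conclusion («somewhere an `L`-ball passes the relaxed
gapped-twelve test `RT a' t` at ONE admissible spacing `a'`») mentions no energy and which force balance alone cannot give.

THIS FILE states the pieces; `…OverbindingBudgetEdgeRelaxation` proves the reductions; `…OverbindingBudgetEdgeRelaxationTyping` proves the
scale-free typing of robust violators and the typed split.

* §A `RecurrentLiouBallsU T₀ D` — LIOUBᵘ restricted to its EXTREMAL CLASS: the texture may be assumed ROOTED (`0 ∈ Y`) and UNIFORMLY RECURRENT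
  (`UniformlyRecurrent`, two-way local matchings `Match` of `MuGSC`).  Lens-4 move (template: generations 21/22, laws 3/4/5): a counterexample to
  LIOUBᵘ blows down, inside the re-rooting- and limit-closed hull family of its hypotheses (all limit-closed by LANDED lemmas: `solid_of_limit`,
  `muGSCLimitClosed`, `thinCoresL_of_limit`, `rtAbove_of_limit_spacing` + `rt_of_rtAbove`, `violatorsL_of_limit`), to a uniformly recurrent
  counterexample by the hull engine `minimalRecurrent` (Birkhoff).  KERNEL-WEAKER than LIOUBᵘ (restriction).
* §B `StrainedCubes κ Y` and the **edge-relaxation law** `EdgeRelaxationLaw T₀ D`: a rooted, uniformly recurrent, uniformly discrete,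
  `9/10`-covering texture with loosened thin cores (radius `D`, admissible host spacing) that passes `RT a T₀` EVERYWHERE at an admissible `a`
  but carries, for some `t > 0` and `L`, `t`-robust violators `L`-densely at EVERY admissible spacing («strained»: no `L`-ball fits one scale)
  is BEATEN BY THE FINITE GROUND STATES BY A VOLUME-ORDER AMOUNT: for some `κ > 0`, cofinally in `ℓ`, some cube chunk `F = Y ∩ Q_ℓ(c)` has
  `E(#F) + κ ℓ³ ≤ ½ ∑_{y,w ∈ F} V_LJ(|y − w|)` (its own interaction energy).  This law is `e`-FREE and `μ`-FREE — a purely variational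
  statement («strained clean chunks can be relaxed»): it USES the energy, through the removal test of `μ`-stability
  (`stub_removalUpperBound`), the cross-field estimate `stub_crossTermSmall` and the lower bound `e ≤ E(N)/N`, to contradict the
  `μ`-ground-state hypothesis of `RecurrentLiouBallsU` (`…EdgeRelaxation.recurrentLiouBallsU_of_edgeRelaxationLaw`).
* §C the SCALE-FREE TYPES of a strained ball — `LongAt`, `ShortAt`, `LowGapAt`, `ContrastAt`, `GapClashAt` (no admissible scale `a'` and
  no host scale `a` occurs: «near pair» = distance `≤ 11/10`, «far pair» = distance `> 11/10`) — and the five TYPED relaxation laws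
  `LongRelaxationLaw … GapClashRelaxationLaw` (same conclusion, hypothesis «type-X witnesses `L`-densely»).  `…EdgeRelaxationTyping` proves
  that an `L`-ball violating `RT a' s` at EVERY admissible `a'` has one of the five types at margin `s` (`types_of_violators`), that types
  recur with bounded gaps in a uniformly recurrent texture, and hence `EdgeRelaxationLaw ⟸ the five typed laws`.
* §D readable record pins.
-/

namespace Summit.AtomisticToContinuum.Crystallization.Theorems.OverbindingBudgetEdgeRelaxationStatements

open Filter Metric Set Topology
open scoped BigOperators
open Literature.MathematicalPhysics.StatisticalMechanics
open Summit.AtomisticToContinuum.Crystallization.Theorems.OverbindingBudgetViolatorDensityFloor (RT)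
open Summit.AtomisticToContinuum.Crystallization.Theorems.OverbindingBudgetRecurrentSealStatements (UniformlyRecurrent)
open Summit.AtomisticToContinuum.Crystallization.Theorems.OverbindingBudgetRecurrentDustStatements (ThinCoresL ViolatorsL)
open Summit.AtomisticToContinuum.Crystallization.Theorems.OverbindingBudgetUniformCutDensity (CleanLiouvilleBallsU)

/-! ## §A  LIOUBᵘ on its extremal class -/

/-- **`RecurrentLiouBallsU T₀ D`** — `CleanLiouvilleBallsU T₀ D` VERBATIM with two extra hypotheses on the texture: ROOTED (`0 ∈ Y`) and
UNIFORMLY RECURRENT.  (`…EdgeRelaxation.liouBallsU_of_recurrent`: this already gives LIOUBᵘ, `0 ≤ T₀`.) -/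
def RecurrentLiouBallsU (T₀ D : ℝ) : Prop :=
  ∀ e : ℝ, Filter.Tendsto (fun N : ℕ => groundStateEnergy lennardJones 3 N / N) Filter.atTop (nhds e) →
    (∀ N : ℕ, 0 < N → e ≤ groundStateEnergy lennardJones 3 N / N) →
    ∀ Y : Set (EuclideanSpace ℝ (Fin 3)), UniformlyDiscrete Y → (0 : EuclideanSpace ℝ (Fin 3)) ∈ Y → UniformlyRecurrent Y →
      (∀ z : EuclideanSpace ℝ (Fin 3), ∃ w ∈ Y, dist z w ≤ 9 / 10) →
      IsMuGSC lennardJones e Y → ∀ b : ℝ, 47 / 50 ≤ b → b ≤ 1 → ThinCoresL b D Y →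
      ∀ a : ℝ, 47 / 50 ≤ a → a ≤ 1 → (∀ y ∈ Y, RT a T₀ Y y) →
        ∀ t : ℝ, 0 < t → ∀ L : ℝ, ∃ a' : ℝ, 47 / 50 ≤ a' ∧ a' ≤ 1 ∧ ∃ q ∈ Y, ∀ y ∈ Y, dist y q ≤ L → RT a' t Y y

/-! ## §B  Strained chunks and the edge-relaxation law -/

/-- **`StrainedCubes κ Y`**: cofinally in the side `ℓ`, some half-open cube chunk `F = Y ∩ Q_ℓ(c)` of the texture is beaten by the
`#F`-particle Lennard-Jones ground-state energy by `κ ℓ³`:  `E(#F) + κ ℓ³ ≤ ½ ∑_{y ∈ F} ∑_{w ∈ F} V_LJ(dist y w)` (the right-hand side is the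
interaction energy of the chunk, `V_LJ(0) = 0` on the diagonal). -/
def StrainedCubes (κ : ℝ) (Y : Set (EuclideanSpace ℝ (Fin 3))) : Prop :=
  ∀ ℓ₀ : ℝ, ∃ ℓ : ℝ, ℓ₀ ≤ ℓ ∧ ∃ c : EuclideanSpace ℝ (Fin 3), ∃ F : Finset (EuclideanSpace ℝ (Fin 3)),
    (↑F : Set (EuclideanSpace ℝ (Fin 3))) = Y ∩ {z | ∀ i : Fin 3, c i ≤ z i ∧ z i < c i + ℓ} ∧
      groundStateEnergy lennardJones 3 F.card + κ * ℓ ^ 3 ≤ 1 / 2 * ∑ y ∈ F, ∑ w ∈ F, lennardJones (dist y w)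

/-- **The recurrent clean class `CleanClass T₀ D Y`**: `Y` is uniformly discrete, rooted, uniformly recurrent and `9/10`-covering, has
loosened thin cores of radius `D` at SOME admissible host spacing `b ∈ [47/50, 1]`, and passes the relaxed gapped-twelve test `RT a T₀` at
EVERY site at SOME admissible spacing `a ∈ [47/50, 1]`. -/
def CleanClass (T₀ D : ℝ) (Y : Set (EuclideanSpace ℝ (Fin 3))) : Prop :=
  UniformlyDiscrete Y ∧ (0 : EuclideanSpace ℝ (Fin 3)) ∈ Y ∧ UniformlyRecurrent Y ∧
    (∀ z : EuclideanSpace ℝ (Fin 3), ∃ w ∈ Y, dist z w ≤ 9 / 10) ∧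
    (∃ b : ℝ, 47 / 50 ≤ b ∧ b ≤ 1 ∧ ThinCoresL b D Y) ∧
    ∃ a : ℝ, 47 / 50 ≤ a ∧ a ≤ 1 ∧ ∀ y ∈ Y, RT a T₀ Y y

/-- **The edge-relaxation law `EdgeRelaxationLaw T₀ D`** (RELAX): a texture of the recurrent clean class that carries, for some `t > 0` and
some radius `L`, `t`-robust violators of the relaxed test `L`-densely at EVERY admissible spacing `a'` (`ViolatorsL a' t L Y`: within `L` of
every site a site failing `RT a' s` at every margin `s ∈ (0, t)`) has strained cubes: `∃ κ > 0, StrainedCubes κ Y`.  No energy density `e`,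
no `μ`-stability in the statement. -/
def EdgeRelaxationLaw (T₀ D : ℝ) : Prop :=
  ∀ Y : Set (EuclideanSpace ℝ (Fin 3)), CleanClass T₀ D Y → ∀ t : ℝ, 0 < t → ∀ L : ℝ,
    (∀ a' : ℝ, 47 / 50 ≤ a' → a' ≤ 1 → ViolatorsL a' t L Y) → ∃ κ : ℝ, 0 < κ ∧ StrainedCubes κ Y

/-! ## §C  Scale-free types of a strained ball and the typed relaxation laws -/

/-- Type LONG at `q` (margin `t`, radius `L`): a near pair (`dist ≤ 11/10`) at a site within `L` of `q` longer than `51/50 + t` — too long for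
every admissible scale `a' ≤ 1`. -/
def LongAt (t L : ℝ) (Y : Set (EuclideanSpace ℝ (Fin 3))) (q : EuclideanSpace ℝ (Fin 3)) : Prop :=
  ∃ y ∈ Y, ∃ w ∈ Y, dist y q ≤ L ∧ w ≠ y ∧ dist y w ≤ 11 / 10 ∧ 51 / 50 + t < dist y w

/-- Type SHORT at `q`: a pair at a site within `L` of `q` shorter than `49/50 · 47/50 − t = 2303/2500 − t` — too short for every admissible
scale `a' ≥ 47/50`. -/
def ShortAt (t L : ℝ) (Y : Set (EuclideanSpace ℝ (Fin 3))) (q : EuclideanSpace ℝ (Fin 3)) : Prop :=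
  ∃ y ∈ Y, ∃ w ∈ Y, dist y q ≤ L ∧ w ≠ y ∧ dist y w < 2303 / 2500 - t

/-- Type LOWGAP at `q`: a far pair (`dist > 11/10`) at a site within `L` of `q` shorter than `63/50 · 47/50 − t = 2961/2500 − t` — inside the
gap of every admissible scale `a' ≥ 47/50`. -/
def LowGapAt (t L : ℝ) (Y : Set (EuclideanSpace ℝ (Fin 3))) (q : EuclideanSpace ℝ (Fin 3)) : Prop :=
  ∃ y ∈ Y, ∃ w ∈ Y, dist y q ≤ L ∧ 11 / 10 < dist y w ∧ dist y w < 2961 / 2500 - t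

/-- Type CONTRAST at `q`: two near pairs at sites within `L` of `q` with `49/50 · d₁ − 51/50 · d₂ > 2t` — no window
`[49/50 · a' − s, 51/50 · a' + s]`, `s < t`, holds both. -/
def ContrastAt (t L : ℝ) (Y : Set (EuclideanSpace ℝ (Fin 3))) (q : EuclideanSpace ℝ (Fin 3)) : Prop :=
  ∃ y ∈ Y, ∃ w ∈ Y, ∃ y' ∈ Y, ∃ w' ∈ Y, dist y q ≤ L ∧ dist y' q ≤ L ∧ w ≠ y ∧ w' ≠ y' ∧ dist y w ≤ 11 / 10 ∧ dist y' w' ≤ 11 / 10 ∧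
    2 * t < 49 / 50 * dist y w - 51 / 50 * dist y' w'

/-- Type GAPCLASH at `q`: a near pair and a far pair at sites within `L` of `q` with `63/50 · d_near − 51/50 · d_far > 57/25 · t` — no scale has
the near pair inside its window and the far pair beyond its gap. -/
def GapClashAt (t L : ℝ) (Y : Set (EuclideanSpace ℝ (Fin 3))) (q : EuclideanSpace ℝ (Fin 3)) : Prop :=
  ∃ y ∈ Y, ∃ w ∈ Y, ∃ y' ∈ Y, ∃ w' ∈ Y, dist y q ≤ L ∧ dist y' q ≤ L ∧ w ≠ y ∧ dist y w ≤ 11 / 10 ∧ 11 / 10 < dist y' w' ∧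
    57 / 25 * t < 63 / 50 * dist y w - 51 / 50 * dist y' w'

/-- **Typed law LONG**: a texture of the recurrent clean class with type-LONG witnesses `L`-densely (margin `t > 0`) has strained cubes. -/
def LongRelaxationLaw (T₀ D : ℝ) : Prop :=
  ∀ Y : Set (EuclideanSpace ℝ (Fin 3)), CleanClass T₀ D Y → ∀ t : ℝ, 0 < t → ∀ L : ℝ, (∀ q ∈ Y, LongAt t L Y q) →
    ∃ κ : ℝ, 0 < κ ∧ StrainedCubes κ Y

/-- **Typed law SHORT.** -/
def ShortRelaxationLaw (T₀ D : ℝ) : Prop :=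
  ∀ Y : Set (EuclideanSpace ℝ (Fin 3)), CleanClass T₀ D Y → ∀ t : ℝ, 0 < t → ∀ L : ℝ, (∀ q ∈ Y, ShortAt t L Y q) →
    ∃ κ : ℝ, 0 < κ ∧ StrainedCubes κ Y

/-- **Typed law LOWGAP.** -/
def LowGapRelaxationLaw (T₀ D : ℝ) : Prop :=
  ∀ Y : Set (EuclideanSpace ℝ (Fin 3)), CleanClass T₀ D Y → ∀ t : ℝ, 0 < t → ∀ L : ℝ, (∀ q ∈ Y, LowGapAt t L Y q) →
    ∃ κ : ℝ, 0 < κ ∧ StrainedCubes κ Y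

/-- **Typed law CONTRAST.** -/
def ContrastRelaxationLaw (T₀ D : ℝ) : Prop :=
  ∀ Y : Set (EuclideanSpace ℝ (Fin 3)), CleanClass T₀ D Y → ∀ t : ℝ, 0 < t → ∀ L : ℝ, (∀ q ∈ Y, ContrastAt t L Y q) →
    ∃ κ : ℝ, 0 < κ ∧ StrainedCubes κ Y

/-- **Typed law GAPCLASH.** -/
def GapClashRelaxationLaw (T₀ D : ℝ) : Prop :=
  ∀ Y : Set (EuclideanSpace ℝ (Fin 3)), CleanClass T₀ D Y → ∀ t : ℝ, 0 < t → ∀ L : ℝ, (∀ q ∈ Y, GapClashAt t L Y q) →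
    ∃ κ : ℝ, 0 < κ ∧ StrainedCubes κ Y

/-! ## §D  Elementary relations -/

/-- LIOUBᵘ ⇒ its restriction to the extremal class (the piece `RecurrentLiouBallsU` is KERNEL-WEAKER than the target). [this file] -/
theorem recurrentLiouBallsU_of_liouBallsU {T₀ D : ℝ} (h : CleanLiouvilleBallsU T₀ D) : RecurrentLiouBallsU T₀ D :=
  fun e hT hlb Y hUD _ _ hcov hμ b hb1 hb2 hthin a ha1 ha2 hclean t ht L =>
    h e hT hlb Y hUD hcov hμ b hb1 hb2 hthin a ha1 ha2 hclean t ht L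

/-- Monotonicity of `StrainedCubes` in `κ`. [this file] -/
theorem strainedCubes_mono {κ κ' : ℝ} {Y : Set (EuclideanSpace ℝ (Fin 3))} (hκ : κ' ≤ κ) (h : StrainedCubes κ Y) :
    StrainedCubes κ' Y := by
  intro ℓ₀
  obtain ⟨ℓ, hℓ, c, F, hF, hE⟩ := h (max ℓ₀ 0)
  refine ⟨ℓ, (le_max_left _ _).trans hℓ, c, F, hF, le_trans ?_ hE⟩
  have hℓ0 : 0 ≤ ℓ := (le_max_right _ _).trans hℓ
  nlinarith [pow_nonneg hℓ0 3]

end Summit.AtomisticToContinuum.Crystallization.Theorems.OverbindingBudgetEdgeRelaxationStatements
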